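import Summits.BirchSwinnertonDyer.Rank1Residual.Additive.X4SharpThreeKimShape
import Literature.NumberTheory.EllipticCurves.Kim2026.ShaLengthRankZeroLowerBound
import HarnessLib
import HarnessLib.Audit.Tags

/-!
# N11 — Kim 2026 Thm. 1.8 (6) at `p = 3` BEYOND THE UNIT CASE and Kim's REFINED conjecture
# (Conj. 1.10: `∂^{(∞)}(δ̃) = ord_p ∏ c_ℓ`) at `p = 3`, TYPED in the tree's Kurihara binder shape
# (cell `b2b-bsdres`, team n1011, seat p03, OWNERS row T-a2 — lead's spec PLAN.md §3 T-a2 (i)–(iii);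
# STATEMENTS: four per-pair predicates, one certificate predicate, four class conjectures; sequel of
# `Additive/X4SharpThreeKimShape.lean`)

HONEST FRAMING (cell `b2b-bsdres`, run/shared/lean/b2b/bsd-rank1-residual/, verbatim in every
file): the goal of the cell is to DELETE the COMBINATION-SHAPED residual classes of the
Birch–Swinnerton-Dyer formula for ALL analytic-rank `≤ 1` elliptic curves over `ℚ` — "full BSD
formula for every rank `≤ 1` curve in class `C`" assembled STRICTLY from published theorems — so
that the rank-`≤ 1` remainder becomes exactly the CONSTRUCTION-SHAPED classes, which are TYPED
(missing-input `Prop`s), NOT attempted. This is not "finishing BSD". Team n1011 (N10 / N11): prove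
what is provable now; shrink each hard class to its core with data; no claim beyond stated classes.
Research routes; census output = EVIDENCE / conjecture items, never a Literature fact. The label X4
is UNCHANGED by this file; nothing is booked; NOTHING below is asserted — `def … : Prop` only, plus
bookkeeping theorems. ANNOUNCED ≠ PROVED: C.-H. Kim (with an appendix by R. Pollack), *The refined
Tamagawa number conjectures for GL₂*, arXiv:2505.09121v1 (2025) Thm. 1.1 / Cor. 1.7 announce Kim's
structure theorem for `p ≥ 3` under LARGE IMAGE (`ρ_f(G_{ℚ(μ_{p^∞})}) ⊇ SL₂(ℤ_p)`, = Kato's (12.5.2))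
at any level — a PREPRINT; by the cell's absolute rule it enters only as an explicitly labelled OPEN
hypothesis, which is what the `@[conjecture]` predicates below are (its typing as a cited open
Literature fact is OWNERS row T-a4, seat p09).

## What this file types (lead's T-a2 (i)–(iii))

* §1 `KimRankZeroLowerBoundAt W p` — clause (6) in analytic rank `0`, LOWER direction BEYOND THE
  UNIT CASE, per pair: the body of p11's tree fact
  `Kim2026.rankZero_le_padicValNat_sha_of_kuriharaNumber_ne_zero` (a Kurihara number non-zero mod
  `p^k` at a cyclic level `n ∈ 𝒩_k` ⟹ `ord_p(L(E,1)/Ω) ≤ ord_p #Ш(p) + (k − 1)`) with `5 ≤ p`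
  REMOVED and the tower binder ADDED; `KimRankZeroUpperDivBoundAt W p` — the UPPER direction with
  divisibility (`∂^{(∞)} ≥ m`: every Kurihara number at every level `n ∈ 𝒩_k` divisible by
  `p^{min(m,k)}` ⟹ `ord_p #Ш(p) + m ≤ ord_p(L(E,1)/Ω)`), same binder family (harvest-2 E67 types the
  `5 ≤ p` fact). STEP-0 in the kernel: `kimRankZeroLowerBoundAt_of_five_le` (p11's fact); the unit
  shape of the sibling file is LOWER(k = 1) ∧ the inequality shape (`kimRankZeroUnitBoundAt_of_lower_of_bound`).
* §2 `KuriharaIndexLeAt W p f m` — the CERTIFICATE "`∂^{(∞)}(δ̃) ≤ m` witnessed at a cyclic level":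
  a Kurihara number non-zero mod `p^k` with `k ≤ m + 1` (at `m = 0` exactly `X4.KuriharaUnitAt`).
* §3 Kim's REFINED conjecture (AJM 148 (2026) Conj. 1.9 = arXiv v4 Conj. 1.10: `∂^{(∞)}(δ̃) = Σ_ℓ ord_p c_ℓ`;
  Kim–Pollack 2025 §(formulation): the "analytic fudge factor") at the pair, in BSD currency and with
  `c_p` INCLUDED (team ruling R1-2 / ROUTE-1 F-b: at an additive `3` Kodaira IV/IV* has `c₃ = 3`):
  `KimRefinedIndexLeAt W p` (the `≤` half, an EXISTENCE statement — the half that yields the LOWER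
  bound of BSD) and `KimRefinedIndexGeAt W p` (the `≥` half, universal — the half that sharpens the
  upper bound to equality). Registered form A0 (no extra period-index term); alternatives (A1: index
  of the Ω_E-normalised symbols; A2: `c₃` excluded) are prose in cells/n1011/skel/T-a2.md until the
  census (CLASS-CLOSURE §3.1 E1, instrument I-12@3) forces one — then a NEW def, never an edit.
* §4 The N11 class versions (`Addv W 3`): `X4SharpThreeKimLower`, `X4SharpThreeKimUpperDiv`,
  `X4SharpThreeRefinedLe`, `X4SharpThreeRefinedGe`. The reductions (lead's (ii)) —
  LOWER ∧ RefinedLe ⟹ `MissingLowerBoundAt W 3`; UpperDiv ∧ RefinedGe ⟹ `MissingUpperBoundAt W 3`;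
  all four ⟹ `MissingPPartAt W 3` / `BSD(E,3)` on every N11 tower row with a Manin datum; and the
  per-row certificate closers — are the sibling file `Additive/X4SharpThreeKimRefinedConsequences.lean`.

References: C.-H. Kim, Amer. J. Math. 148 (2026) 79–129 = arXiv:2203.12159v4, Thm. 1.9 (6), §1.5.1
(`∂^{(i)}`, `∂^{(∞)}`), Conj. 1.10, §1.2.5 [Kim2022StructureSelmer]; C.-H. Kim (app. R. Pollack),
arXiv:2505.09121v1 (2025) Thm. 1.1, Cor. 1.7, §1.1.3, §3.2.2 (PREPRINT); R. Sakamoto, J. Théor.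
Nombres Bordeaux 36 (2024) 919–946 (Kolyvagin systems for `p = 3`); R. Sakamoto, Doc. Math. 27 (2022)
App. §5 [Sakamoto2022pSelmer]; Rubin, PCMS 18 (2011) §2.4 (H.4), §3.4; Miller 2011 Def. 1.1 [Miller2011LMS].
-/

noncomputable section

open scoped Classical MatrixGroups ModularForm

open CongruenceSubgroup WeierstrassCurve Literature.NumberTheory.EllipticCurves
  Literature.NumberTheory.EllipticCurves.ModularForms
  Literature.NumberTheory.EllipticCurves.Rank1Residual
  Literature.NumberTheory.EllipticCurves.Rank1Residual.Typed

namespace Summit.BirchSwinnertonDyer.Rank1Residual.Additive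

/-! ## §1 Clause (6) beyond the unit case: the LOWER direction and the divisibility UPPER direction -/

/-- **Kim's clause (6) at the pair `(E, p)`, LOWER direction at level `k`**: the body of the tree
fact `Kim2026.rankZero_le_padicValNat_sha_of_kuriharaNumber_ne_zero` (seat n1011-p11) at `(W, p)`
with `5 ≤ p` REMOVED and the tower binder ADDED — `ρ̄_{E,p}` onto, tower onto, `L(E,1) ≠ 0`, `Ш`
finite, datum `D` with `p ∤ c_D`, period transfer, a level `n ∈ 𝒩_k(E,p)` (`1 ≤ k`) with cyclic
reductions, surjective `ψ_ℓ : (ℤ/ℓ)ˣ ↠ ℤ/p^k`, `kuriharaNumber D.f (p^k) n ψ ≠ 0` (so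
`∂^{(∞)}(δ̃) ≤ k − 1`) ⟹ `L(E,1)/Ω(W) = q ∈ ℚ` with `ord_p q ≤ ord_p #Ш(E/ℚ)(p) + (k − 1)`.
A predicate; nothing asserted; a THEOREM at `5 ≤ p` (`kimRankZeroLowerBoundAt_of_five_le`); at
`p = 3` ANNOUNCED (Kim–Pollack 2025 Cor. 1.7, PRE) under large image.
[cite: Kim2022StructureSelmer, Thm. 1.9 (6) (PDF p. 8), §1.5.1 (PDF p. 7)] -/
@[conjecture] def KimRankZeroLowerBoundAt (W : WeierstrassCurve ℚ) [W.IsElliptic] [W.IsGloballyMinimal]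
    (p : ℕ) [Fact p.Prime] : Prop :=
  W.HasSurjectiveModNGaloisRep p → (∀ n : ℕ, W.HasSurjectiveModNGaloisRep (p ^ n : ℕ)) →
    W.entireLFunction 1 ≠ 0 → Finite W.sha →
    ∀ {N : ℕ} [NeZero N] (D : ModularParametrizationData W N), ¬ (p : ℤ) ∣ D.maninConstant →
    (∃ u : ℚ, ‖(u : ℚ_[p])‖ = 1 ∧ W.realPeriodRat = u * plusPeriod D.f) →
    ∀ (k n : ℕ) [NeZero n], 1 ≤ k → Kato.IsKolyvaginProduct W p k n →
    (∀ (ℓ : ℕ) [Fact ℓ.Prime], ℓ ∣ n →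
      Nat.card {P : ((WeierstrassCurve.integralModelInt W).map
          (Int.castRingHom (ZMod ℓ))).toAffine.Point // p • P = 0} ≤ p) →
    ∀ ψ : (ℓ : ℕ) → (ZMod ℓ)ˣ →* Multiplicative (ZMod (p ^ k)),
      (∀ ℓ ∈ n.primeFactors, Function.Surjective (ψ ℓ)) →
      kuriharaNumber D.f (p ^ k) n ψ ≠ 0 →
    ∃ q : ℚ, W.entireLFunction 1 / (W.realPeriodRat : ℂ) = (q : ℂ) ∧
      padicValRat p q ≤
        (padicValNat p (Nat.card (AddCommGroup.primaryComponent W.sha p)) : ℤ) + ((k - 1 : ℕ) : ℤ)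

/-- **Kim's clause (6) at the pair `(E, p)`, UPPER direction with a divisibility exponent `m`**
(`∂^{(∞)}(δ̃) ≥ m ⟹ length Ш[p^∞] ≤ ∂^{(0)}(δ̃) − m`): `ρ̄_{E,p}` onto, tower onto, `L(E,1) ≠ 0`,
`Ш` finite, datum `D` with `p ∤ c_D`, period transfer; IF every Kurihara number at every level
`n ∈ 𝒩_k(E,p)` (`1 ≤ k`, literal `𝒩_k`, every surjective `ψ`) is divisible by `p^{min(m,k)}` in
`ℤ/p^k`, THEN `L(E,1)/Ω(W) = q ∈ ℚ` with `ord_p #Ш(E/ℚ)(p) + m ≤ ord_p q`. At `m = 0` this is the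
inequality shape `KimRankZeroBoundAt` (hypothesis vacuous). Same binder family as the LOWER shape;
the `5 ≤ p` Literature fact of this direction is harvest-2's (E67, in flight). A predicate; nothing
asserted. [cite: Kim2022StructureSelmer, Thm. 1.9 (6) (PDF p. 8), §1.5.1 (PDF p. 7)] -/
@[conjecture] def KimRankZeroUpperDivBoundAt (W : WeierstrassCurve ℚ) [W.IsElliptic]
    [W.IsGloballyMinimal] (p : ℕ) [Fact p.Prime] : Prop :=
  W.HasSurjectiveModNGaloisRep p → (∀ n : ℕ, W.HasSurjectiveModNGaloisRep (p ^ n : ℕ)) →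
    W.entireLFunction 1 ≠ 0 → Finite W.sha →
    ∀ {N : ℕ} [NeZero N] (D : ModularParametrizationData W N), ¬ (p : ℤ) ∣ D.maninConstant →
    (∃ u : ℚ, ‖(u : ℚ_[p])‖ = 1 ∧ W.realPeriodRat = u * plusPeriod D.f) →
    ∀ m : ℕ,
    (∀ (k n : ℕ) [NeZero n], 1 ≤ k → Kato.IsKolyvaginProduct W p k n →
      ∀ ψ : (ℓ : ℕ) → (ZMod ℓ)ˣ →* Multiplicative (ZMod (p ^ k)),
        (∀ ℓ ∈ n.primeFactors, Function.Surjective (ψ ℓ)) →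
        ((p ^ min m k : ℕ) : ZMod (p ^ k)) ∣ kuriharaNumber D.f (p ^ k) n ψ) →
    ∃ q : ℚ, W.entireLFunction 1 / (W.realPeriodRat : ℂ) = (q : ℂ) ∧
      (padicValNat p (Nat.card (AddCommGroup.primaryComponent W.sha p)) : ℤ) + m ≤ padicValRat p q

variable (W : WeierstrassCurve ℚ) [W.IsElliptic] [W.IsGloballyMinimal] (p : ℕ) [Fact p.Prime]

/-- **STEP-0 in the kernel (LOWER shape): at `5 ≤ p` the per-pair predicate IS Kim's theorem** in
p11's typed form (tree fact `hKimL`; the tower binder is not used).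
[cite: Kim2022StructureSelmer, Thm. 1.9 (6) (PDF p. 8)] -/
theorem kimRankZeroLowerBoundAt_of_five_le
    (hKimL : Kim2026.rankZero_le_padicValNat_sha_of_kuriharaNumber_ne_zero) (hp : 5 ≤ p) :
    KimRankZeroLowerBoundAt W p :=
  fun hsurj _ hL hfin _ _ D hc hper k n _ hk hn hcyc ψ hψ hδ =>
    hKimL W p hp hsurj hL hfin D hc hper k n hk hn hcyc ψ hψ hδ

/-- **Consistency of the three shapes of clause (6)**: the LOWER shape at level `k = 1` together
with the inequality shape `KimRankZeroBoundAt` gives the unit/EQUALITY shape of the sibling file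
(the two rationals `L(E,1)/Ω(W) = q` coincide). Bookkeeping, fact-free. [folklore] -/
theorem kimRankZeroUnitBoundAt_of_lower_of_bound (hlow : KimRankZeroLowerBoundAt W p)
    (hub : KimRankZeroBoundAt W p) : KimRankZeroUnitBoundAt W p := by
  intro hsurj htower hL hfin N _ D hc hper n _ hn hcyc ψ hψ hδ
  obtain ⟨q, hq, hle⟩ := hlow hsurj htower hL hfin D hc hper 1 n le_rfl hn hcyc ψ hψ hδ
  obtain ⟨q', hq', hge⟩ := hub hsurj htower hL hfin D hc
  have hqq : q' = q := by exact_mod_cast hq'.symm.trans hq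
  subst hqq
  refine ⟨q', hq, le_antisymm ?_ hge⟩
  simpa using hle

/-! ## §2 The certificate "`∂^{(∞)}(δ̃) ≤ m` witnessed at a cyclic level" -/

/-- **Certificate predicate `∂^{(∞)}(δ̃) ≤ m` at the pair `(E, p)` for the newform `f`**: there are
a level `k` with `1 ≤ k ≤ m + 1`, a square-free product `n ∈ 𝒩_k(E,p)` of Kolyvagin primes all of
whose prime factors have cyclic `Ẽ(𝔽_ℓ)[p]` (`#Ẽ(𝔽_ℓ)[p] ≤ p`), and surjective discrete logarithms
`ψ_ℓ : (ℤ/ℓ)ˣ ↠ ℤ/p^k` with `kuriharaNumber f (p^k) n ψ ≠ 0` — i.e. `δ̃_n ∉ p^k(ℤ_p/I_n)`, so the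
index of `δ̃_n` is `≤ k − 1 ≤ m` and `∂^{(∞)}(δ̃) ≤ m` (Kim §1.5.1). At `m = 0` this is exactly the
unit certificate `X4.KuriharaUnitAt W p f` (`kuriharaIndexLeAt_zero_iff`). Per pair this is an open
conjecture of Kurihara type (decided by ONE modular-symbol computation when true); a predicate,
nothing asserted. [cite: Kim2022StructureSelmer, §1.5.1 (PDF p. 7), §1.4.3, Thm. 1.10 (1)]
[cite: Sakamoto2022pSelmer, Conj. 1.1] -/
@[conjecture] def KuriharaIndexLeAt (W : WeierstrassCurve ℚ) [W.IsGloballyMinimal] (p : ℕ) {N : ℕ}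
    [NeZero N] (f : CuspForm (Gamma0 N) 2) (m : ℕ) : Prop :=
  ∃ (k n : ℕ) (_ : NeZero n), 1 ≤ k ∧ k ≤ m + 1 ∧ Kato.IsKolyvaginProduct W p k n ∧
    (∀ (ℓ : ℕ) [Fact ℓ.Prime], ℓ ∣ n →
      Nat.card {P : ((WeierstrassCurve.integralModelInt W).map
          (Int.castRingHom (ZMod ℓ))).toAffine.Point // p • P = 0} ≤ p) ∧
    ∃ ψ : (ℓ : ℕ) → (ZMod ℓ)ˣ →* Multiplicative (ZMod (p ^ k)),
      (∀ ℓ ∈ n.primeFactors, Function.Surjective (ψ ℓ)) ∧ kuriharaNumber f (p ^ k) n ψ ≠ 0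

omit [W.IsElliptic] [Fact p.Prime] in
/-- `∂^{(∞)} ≤ 0` witnessed ⟺ a unit Kurihara number at a cyclic level (`X4.KuriharaUnitAt`): the
level is forced to be `k = 1`. Bookkeeping. [folklore] -/
theorem kuriharaIndexLeAt_zero_iff {N : ℕ} [NeZero N] (f : CuspForm (Gamma0 N) 2) :
    KuriharaIndexLeAt W p f 0 ↔ X4.KuriharaUnitAt W p f := by
  constructor
  · rintro ⟨k, n, hn0, hk1, hk0, hn, hcyc, ψ, hψ, hδ⟩
    obtain rfl : k = 1 := le_antisymm (by simpa using hk0) hk1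
    exact ⟨n, hn0, hn, hcyc, ψ, hψ, hδ⟩
  · rintro ⟨n, hn0, hn, hcyc, ψ, hψ, hδ⟩
    exact ⟨1, n, hn0, le_rfl, by simp, hn, hcyc, ψ, hψ, hδ⟩

omit [W.IsElliptic] [Fact p.Prime] in
/-- Monotonicity: a witness of `∂^{(∞)} ≤ m` witnesses `∂^{(∞)} ≤ m'` for every `m' ≥ m`. [folklore] -/
theorem kuriharaIndexLeAt_mono {N : ℕ} [NeZero N] (f : CuspForm (Gamma0 N) 2) {m m' : ℕ}
    (hmm : m ≤ m') (h : KuriharaIndexLeAt W p f m) : KuriharaIndexLeAt W p f m' := by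
  obtain ⟨k, n, hn0, hk1, hkm, hn, hcyc, ψ, hψ, hδ⟩ := h
  exact ⟨k, n, hn0, hk1, hkm.trans (by omega), hn, hcyc, ψ, hψ, hδ⟩

/-! ## §3 Kim's REFINED conjecture at the pair, in BSD currency, `c_p` included (registered form A0) -/

/-- **Refined conjecture, `≤` half, at `(E, p)`** (Kim 2026 Conj. 1.10 `∂^{(∞)}(δ̃) = Σ_ℓ ord_p c_ℓ`,
the inequality `≤`, as an EXISTENCE statement in the tree's vocabulary): `ρ̄_{E,p}` onto, tower onto,
`L(E,1) ≠ 0`; for every datum `D` with `p ∤ c_D` and the period transfer, SOME cyclic-level Kurihara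
number has index `≤ ord_p ∏_ℓ c_ℓ(E)` — `KuriharaIndexLeAt W p D.f (ord_p ∏ c_ℓ)`, `c_p` INCLUDED
(team ruling R1-2). This is the half of the refined conjecture that, with clause (6), yields the
LOWER bound `ord_p #Ш_an ≤ ord_p #Ш`. On a row with `p ∤ ∏ c_ℓ` it asserts a UNIT Kurihara number
(Kurihara's conjecture). OPEN at every `p`; nothing asserted. [cite: Kim2022StructureSelmer, Conj. 1.10 (PDF p. 8), §1.5.1]
[cite: Sakamoto2022pSelmer, Conj. 1.1] -/
@[conjecture] def KimRefinedIndexLeAt (W : WeierstrassCurve ℚ) [W.IsElliptic] [W.IsGloballyMinimal]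
    (p : ℕ) [Fact p.Prime] : Prop :=
  W.HasSurjectiveModNGaloisRep p → (∀ n : ℕ, W.HasSurjectiveModNGaloisRep (p ^ n : ℕ)) →
    W.entireLFunction 1 ≠ 0 →
    ∀ {N : ℕ} [NeZero N] (D : ModularParametrizationData W N), ¬ (p : ℤ) ∣ D.maninConstant →
    (∃ u : ℚ, ‖(u : ℚ_[p])‖ = 1 ∧ W.realPeriodRat = u * plusPeriod D.f) →
    KuriharaIndexLeAt W p D.f (padicValNat p W.tamagawaProduct)

/-- **Refined conjecture, `≥` half, at `(E, p)`** (Kim 2026 Conj. 1.10, the inequality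
`∂^{(∞)}(δ̃) ≥ Σ_ℓ ord_p c_ℓ`, universal form): `ρ̄_{E,p}` onto, tower onto, `L(E,1) ≠ 0`; for every
datum `D` with `p ∤ c_D` and the period transfer, EVERY Kurihara number at EVERY level `n ∈ 𝒩_k(E,p)`
(literal `𝒩_k`, every surjective `ψ`) is divisible by `p^{min(ord_p ∏ c_ℓ, k)}` in `ℤ/p^k` — Kim's
"Tamagawa defect" of the Kurihara numbers (Büyükboduk 2009 proves ONE factor `c_ℓ` at `p ≥ 5`),
`c_p` INCLUDED. With the UPPER-divisibility shape of clause (6) it sharpens the upper bound to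
`ord_p #Ш ≤ ord_p #Ш_an`. OPEN; nothing asserted. [cite: Kim2022StructureSelmer, Conj. 1.10 (PDF p. 8), Rem. 6.2] -/
@[conjecture] def KimRefinedIndexGeAt (W : WeierstrassCurve ℚ) [W.IsElliptic] [W.IsGloballyMinimal]
    (p : ℕ) [Fact p.Prime] : Prop :=
  W.HasSurjectiveModNGaloisRep p → (∀ n : ℕ, W.HasSurjectiveModNGaloisRep (p ^ n : ℕ)) →
    W.entireLFunction 1 ≠ 0 →
    ∀ {N : ℕ} [NeZero N] (D : ModularParametrizationData W N), ¬ (p : ℤ) ∣ D.maninConstant →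
    (∃ u : ℚ, ‖(u : ℚ_[p])‖ = 1 ∧ W.realPeriodRat = u * plusPeriod D.f) →
    ∀ (k n : ℕ) [NeZero n], 1 ≤ k → Kato.IsKolyvaginProduct W p k n →
    ∀ ψ : (ℓ : ℕ) → (ZMod ℓ)ˣ →* Multiplicative (ZMod (p ^ k)),
      (∀ ℓ ∈ n.primeFactors, Function.Surjective (ψ ℓ)) →
      ((p ^ min (padicValNat p W.tamagawaProduct) k : ℕ) : ZMod (p ^ k)) ∣ kuriharaNumber D.f (p ^ k) n ψ

/-! ## §4 The N11 class conjectures (`Addv W 3`; nothing asserted) -/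

/-- **X4♯(3)-Kim-LOWER**: clause (6), LOWER direction beyond the unit case, on the N11 rows
(`KimRankZeroLowerBoundAt W 3` for every additive `3`). ANNOUNCED (Kim–Pollack 2025 Cor. 1.7, PRE,
large image); OPEN in the tree. [cite: Kim2022StructureSelmer, Thm. 1.9 (6), §1.2.5] -/
@[conjecture] def X4SharpThreeKimLower : Prop :=
  ∀ (W : WeierstrassCurve ℚ) [W.IsElliptic] [W.IsGloballyMinimal],
    Addv W 3 → KimRankZeroLowerBoundAt W 3

/-- **X4♯(3)-Kim-UPPER-DIV**: clause (6), UPPER direction with divisibility, on the N11 rows.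
ANNOUNCED (Kim–Pollack 2025 Cor. 1.7, PRE); OPEN in the tree. [cite: Kim2022StructureSelmer, Thm. 1.9 (6), §1.2.5] -/
@[conjecture] def X4SharpThreeKimUpperDiv : Prop :=
  ∀ (W : WeierstrassCurve ℚ) [W.IsElliptic] [W.IsGloballyMinimal],
    Addv W 3 → KimRankZeroUpperDivBoundAt W 3

/-- **X4♯(3)-REFINED, `≤` half (registered form A0)**: Kim's refined conjecture at `p = 3` on the
N11 rows, existence half — THE typed census conjecture of OWNERS row T-a2 (CLASS-CLOSURE §3.1 E1
target; census protocol cells/n1011/skel/T-a2.md S8). OPEN; nothing asserted.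
[cite: Kim2022StructureSelmer, Conj. 1.10 (PDF p. 8)] -/
@[conjecture] def X4SharpThreeRefinedLe : Prop :=
  ∀ (W : WeierstrassCurve ℚ) [W.IsElliptic] [W.IsGloballyMinimal],
    Addv W 3 → KimRefinedIndexLeAt W 3

/-- **X4♯(3)-REFINED, `≥` half (registered form A0)**: Kim's refined conjecture at `p = 3` on the
N11 rows, universal half. OPEN; nothing asserted. [cite: Kim2022StructureSelmer, Conj. 1.10 (PDF p. 8)] -/
@[conjecture] def X4SharpThreeRefinedGe : Prop :=
  ∀ (W : WeierstrassCurve ℚ) [W.IsElliptic] [W.IsGloballyMinimal],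
    Addv W 3 → KimRefinedIndexGeAt W 3

end Summit.BirchSwinnertonDyer.Rank1Residual.Additive

end
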